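import Mathlib.Analysis.Distribution.SchwartzSpace.Fourier
import Mathlib.Analysis.Fourier.AddCircleMulti
import Mathlib.Analysis.Fourier.FourierTransformDeriv
import Mathlib.Analysis.Calculus.SmoothSeries
import Mathlib.MeasureTheory.Measure.Haar.InnerProductSpace
import Mathlib.Analysis.PSeries
import Mathlib.Topology.Algebra.Order.Floor
import Literature.Analysis.FunctionSpaces.FlatTorus
import HarnessLib

/-!
# Fourier series of compactly supported Schwartz functions: tensor-product approximation

Trunk **T-AQFT** (support file for the density of tensor products of test functions — the named
facts of `Literature.MathematicalPhysics.QuantumLattice.SchwartzTensorDensity` and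
`SchwingerOSAxioms.denseSpan_tensorProducts`, discharged in the planned consumer
`SchwartzTensorDensityProofs`), families `constructive-qft`, `crit-ising`.

Let `V = ℝ^ι` (`EuclideanSpace ℝ ι`, coordinates `x_c`, `c : ι`) and let `G ∈ 𝓢(V, ℂ)` be
supported in the cube `[δ, 1 - δ]^ι`, `0 < δ`. Its `ℤ^ι`-periodisation `g` is a continuous function
on the torus `(ℝ/ℤ)^ι` (`UnitAddTorus ι`) whose Fourier coefficients are the values of the
Fourier transform, `ĝ(n) = 𝓕G(n)`, `n ∈ ℤ^ι`; these decay faster than any power of `|n|`, so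
the Fourier series `∑ₙ ĝ(n) e^{2πi n·x}` converges to `G` on the cube uniformly with all
derivatives (Mathlib: `UnitAddTorus.hasSum_mFourier_series_apply_of_summable`,
`iteratedFDeriv_tsum_apply`). Consequently, for every `P ∈ 𝓢(V, ℂ)` with compact support in the
open unit cube and `P = 1` on `supp G`,

  `G = lim_{s → ℤ^ι} ∑_{n ∈ s} 𝓕G(n) · (P e_n)` in the topology of `𝓢(V, ℂ)`,
  `e_n(x) = e^{2πi ∑_c n_c x_c} = ∏_c e^{2πi n_c x_c}`

(`Literature.MathematicalPhysics.QuantumLattice.tendsto_sum_boxCoeff_smul`), the limit being taken along the filter `atTop` of finite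
subsets `s ⊆ ℤ^ι`. The theorem is stated directly in *affine coordinates* `y = L v + w` on an
arbitrary real normed space `V` (`L : V ≃L[ℝ] ℝ^ι`), i.e. for `G, P ∈ 𝓢(V, ℂ)` supported in the
box `L⁻¹([δ, 1 - δ]^ι - w)`, with coefficients `boxCoeff L w G n = 𝓕(G ∘ (L⁻¹(· - w)))(n)` and
characters `e_n(L v + w)`; this is the form consumed downstream (blocks of variables). Each term `P e_n` is a product of one-variable functions as soon as
`P` is, which is how this file is used: finite linear combinations of tensor products of test
functions are dense in the test functions of several (blocks of) variables (OS 1973 §2,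
`𝒮(ℝ^{4n}) = ⊗̂ⁿ 𝒮(ℝ⁴)`; the classical route through multiple Fourier series with a cutoff, as
in the proof that `C_c^∞(X) ⊗ C_c^∞(Y)` is dense in `C_c^∞(X × Y)`).

## Sources

* K. Osterwalder, R. Schrader, *Axioms for Euclidean Green's functions*, Comm. Math. Phys. 31
  (1973) 83–112, §2 (test function spaces as completed tensor products). The Fourier-series
  density argument itself is textbook folklore (e.g. the proof of the Schwartz kernel theorem);
  the proofs here are self-contained on top of Mathlib.

## Mathlib and Literature

Used from Mathlib: `UnitAddTorus.mFourierCoeff`, `UnitAddTorus.hasSum_mFourier_series_apply_of_summable`,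
`UnitAddTorus.mFourierCoeff_eq_integral`, `AddCircle.equivIco`, `Real.fourier_eq`,
`PiLp.volume_preserving_toLp`, `iteratedFDeriv_tsum_apply`, `norm_iteratedFDeriv_mul_le`,
`ContinuousLinearMap.iteratedFDeriv_comp_right`, `Summable.sum_add_tsum_compl`,
`tendsto_tsum_compl_atTop_zero`. Used from the tree's torus glue
`Literature/Analysis/FunctionSpaces/FlatTorus` (its canonical home): `Literature.Analysis.FunctionSpaces.Torus.repr` (the
representative in `[0,1)^ι`; `perExt G` below is `G ∘ Torus.repr`), `Literature.Analysis.FunctionSpaces.Torus.proj` and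
`Literature.Analysis.FunctionSpaces.Torus.isOpenQuotientMap_proj`, `Literature.Analysis.FunctionSpaces.Torus.latticeVec` (`= intVec`, `intVec_eq_latticeVec`).
Also checked: `TorusFourierCalculus` (`mFourierCoeff_eq_integral_volume`, smooth-function
coefficient decay on the torus) and `TorusRieszFischerParam` (`norm_mFourier_apply`) — they treat
functions living on the torus, not compactly supported functions on `ℝ^ι` and their Fourier
*transform*. Genuinely new here: the derivative bounds for the characters `e_n` (`‖Dᵏe_n‖ ≤
(2π|n|₁)ᵏ`), lattice summability of `𝓕G` against polynomial weights, the identification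
`(perExt G)^(n) = 𝓕G(n)`, `boxCoeff`, and the convergence in the Schwartz topology. Searched and
absent at the pin (Mathlib): any statement that Fourier partial sums of a smooth periodic function
converge in `C^k`, or any density statement for tensor products in `SchwartzMap`.
-/

open scoped Real FourierTransform SchwartzMap Topology
open MeasureTheory Filter Set

noncomputable section

namespace Literature.MathematicalPhysics.QuantumLattice

variable {ι : Type*} [Fintype ι]

/-! ### The characters `e_n(x) = exp (2πi n·x)` on `ℝ^ι` and their derivatives -/

section Char

/-- The one-dimensional character `t ↦ e^{2πit}` (Mathlib's `Real.fourierChar`, coerced to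
`ℂ`) is smooth. [folklore] -/
theorem contDiff_fourierChar {m : WithTop ℕ∞} : ContDiff ℝ m (fun t : ℝ => (𝐞 t : ℂ)) := by
  have h : (fun t : ℝ => (𝐞 t : ℂ)) = fun t : ℝ => Complex.exp ((2 * π * t : ℝ) * Complex.I) :=
    funext fun t => Real.fourierChar_apply t
  rw [h]
  have h1 : ContDiff ℝ m (fun t : ℝ => ((2 * π * t : ℝ) : ℂ) * Complex.I) :=
    (Complex.ofRealCLM.contDiff.comp (contDiff_const.mul contDiff_id)).mul contDiff_const
  exact Complex.contDiff_exp.comp h1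

/-- The one-dimensional character `t ↦ e^{2πit}` has `k`-th derivative `(2πi)^k e^{2πit}`. [folklore] -/
theorem iteratedDeriv_fourierChar (k : ℕ) :
    iteratedDeriv k (fun t : ℝ => (𝐞 t : ℂ)) = fun t => (2 * π * Complex.I) ^ k * (𝐞 t : ℂ) := by
  induction k with
  | zero => funext t; simp
  | succ k ih =>
    rw [iteratedDeriv_succ']
    have hd : deriv (fun t : ℝ => (𝐞 t : ℂ)) = fun t => (2 * π * Complex.I) * (𝐞 t : ℂ) :=
      funext Real.deriv_fourierChar
    rw [hd]
    funext t
    rw [iteratedDeriv_const_mul _ (contDiff_fourierChar (m := (k : ℕ∞))).contDiffAt,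
      congrFun ih t]
    ring

/-- `‖Dᵏ e^{2πit}‖ = (2π)^k`. [folklore] -/
theorem norm_iteratedFDeriv_fourierChar (k : ℕ) (t : ℝ) :
    ‖iteratedFDeriv ℝ k (fun t : ℝ => (𝐞 t : ℂ)) t‖ = (2 * π) ^ k := by
  rw [norm_iteratedFDeriv_eq_norm_iteratedDeriv, iteratedDeriv_fourierChar]
  simp [norm_pow, abs_of_nonneg Real.pi_pos.le]

/-- The linear form `x ↦ n·x = ∑_c n_c x_c` on `ℝ^ι` attached to an integer vector `n ∈ ℤ^ι`. [folklore] -/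
def intForm (n : ι → ℤ) : EuclideanSpace ℝ ι →L[ℝ] ℝ :=
  ∑ c, (n c : ℝ) • EuclideanSpace.proj c

/-- `intForm n x = ∑_c n_c x_c`. [folklore] -/
@[simp]
theorem intForm_apply (n : ι → ℤ) (x : EuclideanSpace ℝ ι) :
    intForm n x = ∑ c, (n c : ℝ) * x c := by
  simp [intForm]

/-- The `ℓ¹` size `|n|₁ = ∑_c |n_c|` of an integer vector, controlling the operator norm of
`intForm n` and hence the derivatives of the character `e_n`. [folklore] -/
def absSum (n : ι → ℤ) : ℝ := ∑ c, |(n c : ℝ)|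

/-- `|n|₁ ≥ 0`. [folklore] -/
theorem absSum_nonneg (n : ι → ℤ) : 0 ≤ absSum n :=
  Finset.sum_nonneg fun _ _ => abs_nonneg _

/-- Each coordinate is bounded by the `ℓ¹` size: `|n_c| ≤ |n|₁`. [folklore] -/
theorem abs_le_absSum (n : ι → ℤ) (c : ι) : |(n c : ℝ)| ≤ absSum n :=
  Finset.single_le_sum (f := fun c => |(n c : ℝ)|) (fun _ _ => abs_nonneg _) (Finset.mem_univ c)

/-- `‖intForm n‖ ≤ |n|₁` (each coordinate projection of `ℝ^ι` has norm `≤ 1`). [folklore] -/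
theorem norm_intForm_le (n : ι → ℤ) : ‖intForm n‖ ≤ absSum n := by
  refine ContinuousLinearMap.opNorm_le_bound _ (absSum_nonneg n) fun x => ?_
  rw [intForm_apply, absSum, Finset.sum_mul, Real.norm_eq_abs]
  refine (Finset.abs_sum_le_sum_abs _ _).trans (Finset.sum_le_sum fun c _ => ?_)
  rw [abs_mul]
  exact mul_le_mul_of_nonneg_left
    ((Real.norm_eq_abs _).symm.trans_le (PiLp.norm_apply_le x c)) (abs_nonneg _)

/-- The character `e_n(x) = e^{2πi n·x} = ∏_c e^{2πi n_c x_c}` on `ℝ^ι`, `n ∈ ℤ^ι` (the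
exponential monomial `UnitAddTorus.mFourier n` pulled back to `ℝ^ι`). [folklore] -/
def eChar (n : ι → ℤ) (x : EuclideanSpace ℝ ι) : ℂ :=
  (𝐞 (intForm n x) : ℂ)

/-- `e_n` is the composition of the one-dimensional character with the linear form `n·x`. [folklore] -/
theorem eChar_eq_comp (n : ι → ℤ) : eChar n = (fun t : ℝ => (𝐞 t : ℂ)) ∘ intForm n := rfl

/-- `e_n` is smooth. [folklore] -/
theorem contDiff_eChar (n : ι → ℤ) {m : WithTop ℕ∞} : ContDiff ℝ m (eChar (ι := ι) n) := by
  rw [eChar_eq_comp]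
  exact contDiff_fourierChar.comp (intForm n).contDiff

/-- `|e_n(x)| = 1`. [folklore] -/
@[simp]
theorem norm_eChar (n : ι → ℤ) (x : EuclideanSpace ℝ ι) : ‖eChar n x‖ = 1 :=
  Circle.norm_coe _

/-- **Derivative bound for the characters**: `‖Dᵏ e_n(x)‖ ≤ (2π |n|₁)^k` (chain rule for the
composition with the linear form `n·x`, `‖n·‖ ≤ |n|₁`). [folklore] -/
theorem norm_iteratedFDeriv_eChar_le (n : ι → ℤ) (k : ℕ) (x : EuclideanSpace ℝ ι) :
    ‖iteratedFDeriv ℝ k (eChar n) x‖ ≤ (2 * π * absSum n) ^ k := by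
  rw [eChar_eq_comp, (intForm n).iteratedFDeriv_comp_right contDiff_fourierChar x
    (i := k) (mod_cast le_top)]
  refine (ContinuousMultilinearMap.norm_compContinuousLinearMap_le _ _).trans ?_
  rw [norm_iteratedFDeriv_fourierChar, Finset.prod_const, Finset.card_univ, Fintype.card_fin]
  calc (2 * π) ^ k * ‖intForm n‖ ^ k ≤ (2 * π) ^ k * absSum n ^ k := by
        gcongr
        exact norm_intForm_le n
    _ = (2 * π * absSum n) ^ k := by ring

end Char

/-! ### Products of a Schwartz function with a function of bounded derivatives -/

section Leibniz

variable {V : Type*} [NormedAddCommGroup V] [NormedSpace ℝ V]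

/-- **Weighted Leibniz bound.** If `P ∈ 𝓢(V, ℂ)` and `T : V → ℂ` is smooth with
`‖Dʲ T(x)‖ ≤ ε j` for `j ≤ l`, then
`‖x‖^k ‖Dˡ(P·T)(x)‖ ≤ ∑_{j ≤ l} (l choose j) ‖P‖_{k,j} ε (l - j)`. [folklore] -/
theorem pow_mul_norm_iteratedFDeriv_mul_le (P : 𝓢(V, ℂ)) {T : V → ℂ}
    (hT : ContDiff ℝ (⊤ : ℕ∞) T) {l : ℕ} {ε : ℕ → ℝ}
    (hε : ∀ j ≤ l, ∀ x, ‖iteratedFDeriv ℝ j T x‖ ≤ ε j) (k : ℕ) (x : V) :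
    ‖x‖ ^ k * ‖iteratedFDeriv ℝ l (fun y => P y * T y) x‖ ≤
      ∑ j ∈ Finset.range (l + 1), (l.choose j : ℝ) * SchwartzMap.seminorm ℂ k j P * ε (l - j) := by
  have hP : ContDiff ℝ (⊤ : ℕ∞) (P : V → ℂ) := P.smooth ⊤
  calc ‖x‖ ^ k * ‖iteratedFDeriv ℝ l (fun y => P y * T y) x‖
      ≤ ‖x‖ ^ k * ∑ j ∈ Finset.range (l + 1), (l.choose j : ℝ) *
          ‖iteratedFDeriv ℝ j P x‖ * ‖iteratedFDeriv ℝ (l - j) T x‖ := by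
        gcongr
        exact norm_iteratedFDeriv_mul_le (N := ((⊤ : ℕ∞) : WithTop ℕ∞)) hP hT x
          (mod_cast le_top)
    _ = ∑ j ∈ Finset.range (l + 1), (l.choose j : ℝ) *
          (‖x‖ ^ k * ‖iteratedFDeriv ℝ j P x‖) * ‖iteratedFDeriv ℝ (l - j) T x‖ := by
        rw [Finset.mul_sum]
        refine Finset.sum_congr rfl fun j _ => ?_
        ring
    _ ≤ ∑ j ∈ Finset.range (l + 1), (l.choose j : ℝ) * SchwartzMap.seminorm ℂ k j P * ε (l - j) := by
        gcongr with j hj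
        · exact SchwartzMap.le_seminorm ℂ k j P x
        · exact hε (l - j) (Nat.sub_le l j) x

end Leibniz



end Literature.MathematicalPhysics.QuantumLattice

namespace Literature.MathematicalPhysics.QuantumLattice

variable {ι : Type*} [Fintype ι]

/-! ### Lattice sums over `ℤ^ι` -/

section Lattice

/-- **Product bound for lattice sums.** If `f : ℤ → ℝ` is nonnegative and summable then
`n ↦ ∏_c f(n_c)` is summable over `ℤ^ι` (all finite partial sums are bounded by
`(∑_k f k)^{|ι|}`, `Finset.prod_univ_sum`). [folklore] -/
theorem summable_pi_prod {f : ℤ → ℝ} (hf : ∀ k, 0 ≤ f k) (hs : Summable f) :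
    Summable fun n : ι → ℤ => ∏ c, f (n c) := by
  classical
  refine summable_of_sum_le (fun n => Finset.prod_nonneg fun c _ => hf (n c)) (c := (∑' k, f k) ^ Fintype.card ι) fun u => ?_
  let t : ι → Finset ℤ := fun c => u.image fun n => n c
  have hsub : u ⊆ Fintype.piFinset t := fun n hn =>
    Fintype.mem_piFinset.2 fun c => Finset.mem_image_of_mem (fun n : ι → ℤ => n c) hn
  calc ∑ n ∈ u, ∏ c, f (n c) ≤ ∑ n ∈ Fintype.piFinset t, ∏ c, f (n c) :=
        Finset.sum_le_sum_of_subset_of_nonneg hsub fun n _ _ => Finset.prod_nonneg fun c _ => hf (n c)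
    _ = ∏ c, ∑ k ∈ t c, f k := (Finset.prod_univ_sum t fun _ k => f k).symm
    _ ≤ ∏ _c : ι, ∑' k, f k := by
        refine Finset.prod_le_prod (fun c _ => Finset.sum_nonneg fun k _ => hf k) fun c _ => ?_
        exact hs.sum_le_tsum (t c) fun k _ => hf k
    _ = (∑' k, f k) ^ Fintype.card ι := by rw [Finset.prod_const, Finset.card_univ]

/-- `∑_{k ∈ ℤ} (1 + |k|)⁻² < ∞`. [folklore] -/
theorem summable_inv_one_add_abs_sq : Summable fun k : ℤ => ((1 + |(k : ℝ)|) ^ 2)⁻¹ := by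
  have h2 : Summable fun k : ℤ => 1 / (k : ℝ) ^ 2 := Real.summable_one_div_int_pow.2 one_lt_two
  refine Summable.of_norm_bounded_eventually h2 ?_
  filter_upwards [eventually_cofinite_ne (0 : ℤ)] with k hk
  have hk0 : (k : ℝ) ≠ 0 := by exact_mod_cast hk
  rw [Real.norm_of_nonneg (by positivity), one_div]
  refine inv_anti₀ (by positivity) ?_
  rw [← sq_abs (k : ℝ)]
  gcongr
  linarith [abs_nonneg (k : ℝ)]

/-- `∑_{n ∈ ℤ^ι} ∏_c (1 + |n_c|)⁻² < ∞`. [folklore] -/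
theorem summable_pi_inv_one_add_abs_sq :
    Summable fun n : ι → ℤ => ∏ c, ((1 + |(n c : ℝ)|) ^ 2)⁻¹ :=
  summable_pi_prod (f := fun k : ℤ => ((1 + |(k : ℝ)|) ^ 2)⁻¹) (fun k => by positivity)
    summable_inv_one_add_abs_sq

/-- The lattice point `n ∈ ℤ^ι` as a vector of `ℝ^ι` (coordinatewise cast; the same vector as the
tree's `Literature.Torus.latticeVec n = ∑ⱼ nⱼ eⱼ` of `FlatTorus`, see `intVec_eq_latticeVec` — kept as a
definition by coordinates so that `intVec_apply` is `rfl` and no `DecidableEq ι` is needed). [folklore] -/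
def intVec (n : ι → ℤ) : EuclideanSpace ℝ ι := WithLp.toLp 2 fun c => (n c : ℝ)

omit [Fintype ι] in
/-- Coordinates of `intVec`. [folklore] -/
@[simp]
theorem intVec_apply (n : ι → ℤ) (c : ι) : intVec n c = (n c : ℝ) := rfl

/-- `intVec` is the lattice embedding `Literature.Analysis.FunctionSpaces.Torus.latticeVec` of `FlatTorus`. [folklore] -/
@[simp]
theorem intVec_eq_latticeVec [DecidableEq ι] (n : ι → ℤ) : intVec n = Literature.Analysis.FunctionSpaces.Torus.latticeVec n := by
  ext c
  simp

/-- Each coordinate is bounded by the Euclidean norm: `|n_c| ≤ ‖n‖`. [folklore] -/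
theorem abs_le_norm_intVec (n : ι → ℤ) (c : ι) : |(n c : ℝ)| ≤ ‖intVec n‖ := by
  have h := PiLp.norm_apply_le (intVec n) c
  rwa [intVec_apply, Real.norm_eq_abs] at h

/-- `|n|₁ ≤ |ι| ‖n‖`. [folklore] -/
theorem absSum_le_card_mul_norm (n : ι → ℤ) : absSum n ≤ Fintype.card ι * ‖intVec n‖ := by
  calc absSum n = ∑ c, |(n c : ℝ)| := rfl
    _ ≤ ∑ _c : ι, ‖intVec n‖ := Finset.sum_le_sum fun c _ => abs_le_norm_intVec n c
    _ = Fintype.card ι * ‖intVec n‖ := by rw [Finset.sum_const, Finset.card_univ, nsmul_eq_mul]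

/-- `∏_c (1 + |n_c|)² ≤ (1 + ‖n‖)^{2|ι|}`. [folklore] -/
theorem prod_one_add_abs_sq_le (n : ι → ℤ) :
    ∏ c, (1 + |(n c : ℝ)|) ^ 2 ≤ (1 + ‖intVec n‖) ^ (2 * Fintype.card ι) := by
  calc ∏ c, (1 + |(n c : ℝ)|) ^ 2 ≤ ∏ _c : ι, (1 + ‖intVec n‖) ^ 2 := by
        refine Finset.prod_le_prod (fun c _ => by positivity) fun c _ => ?_
        gcongr
        exact abs_le_norm_intVec n c
    _ = (1 + ‖intVec n‖) ^ (2 * Fintype.card ι) := by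
        rw [Finset.prod_const, Finset.card_univ, ← pow_mul, mul_comm]

/-- The inner product with a lattice vector is the integer linear form: `⟪x, n⟫ = ∑_c n_c x_c`. [folklore] -/
theorem inner_intVec (x : EuclideanSpace ℝ ι) (n : ι → ℤ) : inner ℝ x (intVec n) = intForm n x := by
  rw [intForm_apply, PiLp.inner_apply]
  refine Finset.sum_congr rfl fun c _ => ?_
  simp [intVec_apply]

end Lattice

/-! ### Periodic extension to the unit torus -/

section Periodic

/-- The **periodic extension** to the unit torus `(ℝ/ℤ)^ι` of a function `G` on `ℝ^ι`: evaluate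
`G` at the representative in `[0, 1)^ι`, i.e. `perExt G = G ∘ Literature.Torus.repr` with the torus glue
of `Literature/Analysis/FunctionSpaces/FlatTorus`. Meaningful (continuous) when `G` vanishes near
the boundary of the unit cube. [folklore] -/
def perExt (G : EuclideanSpace ℝ ι → ℂ) : UnitAddTorus ι → ℂ :=
  G ∘ Literature.Analysis.FunctionSpaces.Torus.repr

omit [Fintype ι] in
/-- On lifts of points of `ℝ^ι`, the periodic extension is `G` at the fractional parts. [folklore] -/
theorem perExt_coe (G : EuclideanSpace ℝ ι → ℂ) (x : ι → ℝ) :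
    perExt G (fun c => ((x c : ℝ) : UnitAddCircle)) = G (WithLp.toLp 2 fun c => Int.fract (x c)) := by
  simp only [perExt, Function.comp_apply, Literature.Analysis.FunctionSpaces.Torus.repr]
  congr 2
  funext c
  rw [AddCircle.coe_equivIco_mk_apply]
  simp

/-- Fractional parts of nearby reals: if `|a - b| < r ≤ 1` then `fract a - fract b - (a - b)` is
`-1`, `0` or `1`. [folklore] -/
theorem fract_sub_fract_near {a b r : ℝ} (h : |a - b| < r) (hr : r ≤ 1) :
    Int.fract a = Int.fract b + (a - b) - 1 ∨ Int.fract a = Int.fract b + (a - b) ∨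
      Int.fract a = Int.fract b + (a - b) + 1 := by
  set k : ℤ := ⌊a⌋ - ⌊b⌋ with hk
  have hrel : Int.fract a = Int.fract b + (a - b) - k := by
    simp only [Int.fract, hk, Int.cast_sub]; ring
  have h1 : |Int.fract a - Int.fract b| < 1 := by
    rw [abs_lt]
    constructor <;> linarith [Int.fract_nonneg a, Int.fract_lt_one a, Int.fract_nonneg b, Int.fract_lt_one b]
  have hab : |a - b| < 1 := h.trans_le hr
  have hk2 : |(k : ℝ)| < 2 := by
    have : (k : ℝ) = (a - b) - (Int.fract a - Int.fract b) := by rw [hrel]; ring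
    rw [this]
    refine (abs_sub _ _).trans_lt ?_
    linarith
  have hk' : k = -1 ∨ k = 0 ∨ k = 1 := by
    rw [abs_lt] at hk2
    have h3 : (-2 : ℤ) < k := by exact_mod_cast hk2.1
    have h4 : k < 2 := by exact_mod_cast hk2.2
    omega
  rcases hk' with h' | h' | h'
  · right; right; rw [hrel, h']; push_cast; ring
  · right; left; rw [hrel, h']; push_cast; ring
  · left; rw [hrel, h']; push_cast; ring

/-- Key to continuity of the periodic extension: if `fract b` is within `δ` of `0` or `1`, then
so is `fract a` for all `a` near `b`, in the form `fract a < δ ∨ 1 - δ < fract a`. [folklore] -/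
theorem fract_near_boundary {b δ : ℝ} (hb : Int.fract b < δ ∨ 1 - δ < Int.fract b) :
    ∃ r > 0, ∀ a, |a - b| < r → Int.fract a < δ ∨ 1 - δ < Int.fract a := by
  have hf0 := Int.fract_nonneg b
  have hf1 := Int.fract_lt_one b
  rcases hb with hb | hb
  · refine ⟨min (δ - Int.fract b) 1, lt_min (by linarith) one_pos, fun a ha => ?_⟩
    have ha1 : |a - b| < δ - Int.fract b := ha.trans_le (min_le_left _ _)
    rw [abs_lt] at ha1
    rcases fract_sub_fract_near ha (min_le_right _ _) with h | h | h
    · left; rw [h]; linarith [min_le_right (δ - Int.fract b) 1]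
    · left; rw [h]; linarith
    · right; rw [h]; linarith
  · refine ⟨min (Int.fract b - (1 - δ)) 1, lt_min (by linarith) one_pos, fun a ha => ?_⟩
    have ha1 : |a - b| < Int.fract b - (1 - δ) := ha.trans_le (min_le_left _ _)
    rw [abs_lt] at ha1
    rcases fract_sub_fract_near ha (min_le_right _ _) with h | h | h
    · left; rw [h]; linarith
    · right; rw [h]; linarith
    · right; rw [h]; linarith

/-- **Continuity of the periodic extension.** If `G` is continuous on `ℝ^ι` and vanishes at every
point having a coordinate `< δ` or `> 1 - δ` (`δ > 0`), then its periodic extension to the unit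
torus is continuous. (Via the open quotient map `ℝ^ι → (ℝ/ℤ)^ι`: `x ↦ G(fract x)` is locally
either a composition of continuous maps or identically zero.) [folklore] -/
theorem continuous_perExt {G : EuclideanSpace ℝ ι → ℂ} (hG : Continuous G) {δ : ℝ} (hδ : 0 < δ)
    (h0 : ∀ x : EuclideanSpace ℝ ι, (∃ c, x c < δ ∨ 1 - δ < x c) → G x = 0) :
    Continuous (perExt G) := by
  -- via the open quotient map `Torus.proj : ℝ^ι → (ℝ/ℤ)^ι` of `FlatTorus`
  rw [← Literature.Analysis.FunctionSpaces.Torus.isOpenQuotientMap_proj.continuous_comp_iff]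
  have hcomp : perExt G ∘ Literature.Analysis.FunctionSpaces.Torus.proj =
      (fun x : ι → ℝ => G (WithLp.toLp 2 fun c => Int.fract (x c))) ∘ WithLp.ofLp :=
    funext fun x => perExt_coe G (WithLp.ofLp x)
  rw [hcomp]
  refine Continuous.comp ?_ (PiLp.continuous_ofLp 2 _)
  refine continuous_iff_continuousAt.2 fun x₀ => ?_
  by_cases hA : ∃ c, Int.fract (x₀ c) < δ ∨ 1 - δ < Int.fract (x₀ c)
  · obtain ⟨c₀, hc₀⟩ := hA
    obtain ⟨r, hr, hnear⟩ := fract_near_boundary hc₀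
    have hev : (fun _ : ι → ℝ => (0 : ℂ)) =ᶠ[𝓝 x₀] fun x => G (WithLp.toLp 2 fun c => Int.fract (x c)) := by
      filter_upwards [Metric.ball_mem_nhds x₀ hr] with x hx
      refine (h0 _ ⟨c₀, ?_⟩).symm
      have hxc : |x c₀ - x₀ c₀| < r := by
        rw [← Real.dist_eq]; exact (dist_le_pi_dist x x₀ c₀).trans_lt hx
      simpa using hnear (x c₀) hxc
    exact continuousAt_const.congr hev
  · push Not at hA
    have hne : ∀ c, x₀ c ≠ ⌊x₀ c⌋ := by
      intro c heq
      have h := (hA c).1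
      rw [heq, Int.fract_intCast] at h
      exact absurd h (not_le.2 hδ)
    have hcont : ContinuousAt
        (fun x : ι → ℝ => (WithLp.toLp 2 fun c => Int.fract (x c) : EuclideanSpace ℝ ι)) x₀ := by
      refine (PiLp.continuous_toLp 2 _).continuousAt.comp ?_
      exact continuousAt_pi.2 fun c =>
        ContinuousAt.comp (f := fun y : ι → ℝ => y c) (x := x₀) (g := Int.fract)
          (continuousAt_fract (hne c)) (continuous_apply c).continuousAt
    exact hG.continuousAt.comp hcont

end Periodic

/-! ### Fourier coefficients of the periodic extension -/

section Coeff

omit [Fintype ι] in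
/-- The exponential monomial of the torus at a lift is the character `e_n`:
`mFourier n (x mod ℤ^ι) = e^{2πi n·x}`. [folklore] -/
theorem mFourier_coe_eq_eChar [Fintype ι] (n : ι → ℤ) (x : ι → ℝ) :
    UnitAddTorus.mFourier n (fun c => ((x c : ℝ) : UnitAddCircle)) = eChar n (WithLp.toLp 2 x) := by
  change (∏ c, fourier (n c) ((x c : ℝ) : UnitAddCircle)) = _
  simp only [fourier_coe_apply, eChar, Real.fourierChar_apply, intForm_apply, ← Complex.exp_sum]
  congr 1
  push_cast
  rw [Finset.mul_sum, Finset.sum_mul]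
  refine Finset.sum_congr rfl fun c _ => ?_
  ring

/-- **The Fourier coefficients of the periodic extension are values of the Fourier transform**:
if `G` vanishes at points with a coordinate `< δ` or `> 1 - δ`, `δ > 0`, then
`(perExt G)^(n) = 𝓕G(n)` for every `n ∈ ℤ^ι` (the coefficient integral over the fundamental cube
`(0, 1]^ι` is the Fourier integral over `ℝ^ι`, the integrand vanishing off the cube). [folklore] -/
theorem mFourierCoeff_perExt (G : EuclideanSpace ℝ ι → ℂ) {δ : ℝ} (hδ : 0 < δ)
    (h0 : ∀ x : EuclideanSpace ℝ ι, (∃ c, x c < δ ∨ 1 - δ < x c) → G x = 0) (n : ι → ℤ) :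
    UnitAddTorus.mFourierCoeff (perExt G) n = 𝓕 G (intVec n) := by
  rw [UnitAddTorus.mFourierCoeff_eq_integral _ _ fun _ => (0 : ℝ), Real.fourier_eq]
  -- the integrand on the fundamental cube
  let Φ : EuclideanSpace ℝ ι → ℂ := fun y => (𝐞 (-(inner ℝ y (intVec n))) : ℂ) • G y
  have hΦ0 : ∀ x : ι → ℝ, (∃ c, x c ≤ 0 ∨ 1 ≤ x c) → G (WithLp.toLp 2 x) = 0 := by
    rintro x ⟨c, hc⟩
    refine h0 _ ⟨c, ?_⟩
    rcases hc with hc | hc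
    · left; change x c < δ; linarith
    · right; change 1 - δ < x c; linarith
  have hI : ∀ x : ι → ℝ, x ∈ {x : ι → ℝ | ∀ i, x i ∈ Ioc (0 : ℝ) (0 + 1)} →
      (UnitAddTorus.mFourier (-n) fun i => ((x i : ℝ) : UnitAddCircle)) •
          perExt G (fun i => ((x i : ℝ) : UnitAddCircle)) = Φ (WithLp.toLp 2 x) := by
    intro x hx
    simp only [Set.mem_setOf_eq, zero_add] at hx
    have h1 : perExt G (fun i => ((x i : ℝ) : UnitAddCircle)) = G (WithLp.toLp 2 x) := by
      rw [perExt_coe]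
      by_cases hone : ∃ c, x c = 1
      · obtain ⟨c, hc⟩ := hone
        rw [hΦ0 x ⟨c, Or.inr hc.ge⟩]
        refine h0 _ ⟨c, Or.inl ?_⟩
        simp [hc, hδ]
      · push Not at hone
        congr 2
        funext c
        exact Int.fract_eq_self.2 ⟨(hx c).1.le, lt_of_le_of_ne (hx c).2 (hone c)⟩
    have h2 : (UnitAddTorus.mFourier (-n) fun i => ((x i : ℝ) : UnitAddCircle)) =
        (𝐞 (-(inner ℝ (WithLp.toLp 2 x) (intVec n))) : ℂ) := by
      rw [mFourier_coe_eq_eChar, inner_intVec, eChar]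
      congr 1
      simp [intForm_apply, Finset.sum_neg_distrib]
    rw [h1, h2]
  have hmeas : MeasurableSet {x : ι → ℝ | ∀ i, x i ∈ Ioc (0 : ℝ) (0 + 1)} := by
    have : {x : ι → ℝ | ∀ i, x i ∈ Ioc (0 : ℝ) (0 + 1)} =
        ⋂ i, (fun x : ι → ℝ => x i) ⁻¹' Ioc 0 (0 + 1) := by
      ext; simp
    rw [this]
    exact MeasurableSet.iInter fun i => measurableSet_Ioc.preimage (measurable_pi_apply i)
  rw [setIntegral_congr_fun hmeas hI]
  -- the integrand vanishes off the cube
  rw [setIntegral_eq_integral_of_forall_compl_eq_zero (fun x hx => by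
      simp only [Set.mem_setOf_eq, zero_add, not_forall, Set.mem_Ioc, not_and_or, not_lt, not_le]
        at hx
      obtain ⟨c, hc⟩ := hx
      change (𝐞 (-(inner ℝ (WithLp.toLp 2 x) (intVec n))) : ℂ) • G (WithLp.toLp 2 x) = 0
      rw [hΦ0 x ⟨c, hc.imp_right fun h => h.le⟩, smul_zero])]
  -- change of variables `ℝ^ι ≃ EuclideanSpace ℝ ι`
  exact (PiLp.volume_preserving_toLp ι).integral_comp
    (MeasurableEquiv.toLp 2 (ι → ℝ)).measurableEmbedding Φ

/-- **Lattice sums of the Fourier transform of a Schwartz function**: for `G ∈ 𝓢(ℝ^ι)`, `a ≥ 0`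
and every `j`, `∑_{n ∈ ℤ^ι} |𝓕G(n)| (a |n|₁)^j < ∞` (Schwartz decay of `𝓕G`,
`(1 + ‖ξ‖)^M |𝓕G(ξ)| ≤ K_M`, against `∑_n ∏_c (1 + |n_c|)⁻² < ∞`). [folklore] -/
theorem summable_norm_fourier_intVec_mul_pow (G : 𝓢(EuclideanSpace ℝ ι, ℂ)) (j : ℕ) {a : ℝ}
    (ha : 0 ≤ a) :
    Summable fun n : ι → ℤ => ‖𝓕 (G : EuclideanSpace ℝ ι → ℂ) (intVec n)‖ * (a * absSum n) ^ j := by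
  set M : ℕ := j + 2 * Fintype.card ι with hM
  set Gh : 𝓢(EuclideanSpace ℝ ι, ℂ) := 𝓕 G with hGh
  have hcoe : (𝓕 (G : EuclideanSpace ℝ ι → ℂ)) = (Gh : EuclideanSpace ℝ ι → ℂ) :=
    (SchwartzMap.fourier_coe G).symm
  set K : ℝ := 2 ^ M *
    ((Finset.Iic (M, 0)).sup fun m => SchwartzMap.seminorm ℂ m.1 m.2) Gh with hK
  have hK0 : 0 ≤ K := mul_nonneg (pow_nonneg zero_le_two _) (apply_nonneg _ _)
  have hdecay : ∀ ξ : EuclideanSpace ℝ ι, (1 + ‖ξ‖) ^ M * ‖Gh ξ‖ ≤ K := by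
    intro ξ
    have h := SchwartzMap.one_add_le_sup_seminorm_apply (𝕜 := ℂ) (m := (M, 0)) (k := M) (n := 0)
      le_rfl le_rfl Gh ξ
    rwa [norm_iteratedFDeriv_zero] at h
  set C : ℝ := (a * Fintype.card ι) ^ j * K with hC
  refine Summable.of_nonneg_of_le
    (fun n => mul_nonneg (norm_nonneg _) (pow_nonneg (mul_nonneg ha (absSum_nonneg n)) _))
    (fun n => ?_) ((summable_pi_inv_one_add_abs_sq (ι := ι)).mul_left C)
  rw [hcoe]
  have hprod_pos : 0 < ∏ c, (1 + |(n c : ℝ)|) ^ 2 := Finset.prod_pos fun c _ => by positivity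
  have h1 : (a * absSum n) ^ j ≤ (a * Fintype.card ι) ^ j * (1 + ‖intVec n‖) ^ j := by
    rw [← mul_pow]
    refine pow_le_pow_left₀ (mul_nonneg ha (absSum_nonneg n)) ?_ j
    rw [mul_assoc]
    refine mul_le_mul_of_nonneg_left ((absSum_le_card_mul_norm n).trans ?_) ha
    exact mul_le_mul_of_nonneg_left (le_add_of_nonneg_left zero_le_one) (Nat.cast_nonneg _)
  have h2 : (1 + ‖intVec n‖) ^ j * ‖Gh (intVec n)‖ * ∏ c, (1 + |(n c : ℝ)|) ^ 2 ≤ K := by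
    calc (1 + ‖intVec n‖) ^ j * ‖Gh (intVec n)‖ * ∏ c, (1 + |(n c : ℝ)|) ^ 2
        ≤ (1 + ‖intVec n‖) ^ j * ‖Gh (intVec n)‖ * (1 + ‖intVec n‖) ^ (2 * Fintype.card ι) := by
          gcongr
          exact prod_one_add_abs_sq_le n
      _ = (1 + ‖intVec n‖) ^ M * ‖Gh (intVec n)‖ := by rw [hM, pow_add]; ring
      _ ≤ K := hdecay _
  have h3 : (1 + ‖intVec n‖) ^ j * ‖Gh (intVec n)‖ ≤ K * ∏ c, ((1 + |(n c : ℝ)|) ^ 2)⁻¹ := by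
    rw [Finset.prod_inv_distrib, ← div_eq_mul_inv, le_div_iff₀ hprod_pos]
    exact h2
  calc ‖Gh (intVec n)‖ * (a * absSum n) ^ j
      ≤ ‖Gh (intVec n)‖ * ((a * Fintype.card ι) ^ j * (1 + ‖intVec n‖) ^ j) := by gcongr
    _ = (a * Fintype.card ι) ^ j * ((1 + ‖intVec n‖) ^ j * ‖Gh (intVec n)‖) := by ring
    _ ≤ (a * Fintype.card ι) ^ j * (K * ∏ c, ((1 + |(n c : ℝ)|) ^ 2)⁻¹) := by gcongr
    _ = C * ∏ c, ((1 + |(n c : ℝ)|) ^ 2)⁻¹ := by rw [hC]; ring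

/-- In the closed unit cube, `G(fract x) = G(x)` for `G` vanishing near the boundary. [folklore] -/
theorem apply_fract_eq_of_mem_Icc {G : EuclideanSpace ℝ ι → ℂ} {δ : ℝ} (hδ : 0 < δ)
    (h0 : ∀ x : EuclideanSpace ℝ ι, (∃ c, x c < δ ∨ 1 - δ < x c) → G x = 0)
    (x : EuclideanSpace ℝ ι) (hx : ∀ c, x c ∈ Icc (0 : ℝ) 1) :
    G (WithLp.toLp 2 fun c => Int.fract (x c)) = G x := by
  by_cases hone : ∃ c, x c = 1
  · obtain ⟨c, hc⟩ := hone
    rw [h0 x ⟨c, Or.inr (by rw [hc]; linarith)⟩]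
    refine h0 _ ⟨c, Or.inl ?_⟩
    simp [hc, hδ]
  · push Not at hone
    have : (fun c => Int.fract (x c)) = fun c => x c :=
      funext fun c => Int.fract_eq_self.2 ⟨(hx c).1, lt_of_le_of_ne (hx c).2 (hone c)⟩
    rw [this]

/-- **Fourier series of a Schwartz function supported inside the unit cube.** If
`G ∈ 𝓢(ℝ^ι)` vanishes at every point with a coordinate `< δ` or `> 1 - δ` (`δ > 0`), then for
every `x` in the closed unit cube `∑_{n ∈ ℤ^ι} 𝓕G(n) e^{2πi n·x} = G(x)`, the series converging
absolutely (`UnitAddTorus.hasSum_mFourier_series_apply_of_summable` for the periodic extension,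
whose coefficients are `𝓕G(n)` and are summable by Schwartz decay). [folklore] -/
theorem hasSum_fourier_mul_eChar (G : 𝓢(EuclideanSpace ℝ ι, ℂ)) {δ : ℝ} (hδ : 0 < δ)
    (h0 : ∀ x : EuclideanSpace ℝ ι, (∃ c, x c < δ ∨ 1 - δ < x c) → G x = 0)
    (x : EuclideanSpace ℝ ι) (hx : ∀ c, x c ∈ Icc (0 : ℝ) 1) :
    HasSum (fun n : ι → ℤ => 𝓕 (G : EuclideanSpace ℝ ι → ℂ) (intVec n) * eChar n x) (G x) := by
  let g : C(UnitAddTorus ι, ℂ) := ⟨perExt G, continuous_perExt G.continuous hδ h0⟩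
  have hcoef : UnitAddTorus.mFourierCoeff g = fun n => 𝓕 (G : EuclideanSpace ℝ ι → ℂ) (intVec n) :=
    funext fun n => mFourierCoeff_perExt G hδ h0 n
  have hsum : Summable (UnitAddTorus.mFourierCoeff g) := by
    rw [hcoef]
    refine Summable.of_norm ?_
    simpa using summable_norm_fourier_intVec_mul_pow G 0 le_rfl (a := 0)
  have h := UnitAddTorus.hasSum_mFourier_series_apply_of_summable hsum
    fun c => ((x c : ℝ) : UnitAddCircle)
  have hgx : g (fun c => ((x c : ℝ) : UnitAddCircle)) = G x := by
    change perExt G _ = _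
    rw [perExt_coe]
    exact apply_fract_eq_of_mem_Icc hδ h0 x hx
  rw [hcoef, hgx] at h
  simpa only [mFourier_coe_eq_eChar, smul_eq_mul, WithLp.toLp_ofLp] using h

end Coeff

/-! ### Convergence in the Schwartz topology, in affine coordinates on a general space -/

section Schwartz

variable {V : Type*} [NormedAddCommGroup V] [NormedSpace ℝ V]

/-- Transport of a test function on `V` to `ℝ^ι` along affine coordinates `y = L v + w`:
`(toCube L w G)(y) = G (L⁻¹ (y - w))` (Mathlib `compSubConstCLM ∘ compCLMOfContinuousLinearEquiv`). [folklore] -/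
def toCube (L : V ≃L[ℝ] EuclideanSpace ℝ ι) (w : EuclideanSpace ℝ ι) (G : 𝓢(V, ℂ)) :
    𝓢(EuclideanSpace ℝ ι, ℂ) :=
  SchwartzMap.compSubConstCLM ℂ w (SchwartzMap.compCLMOfContinuousLinearEquiv ℂ L.symm G)

omit [Fintype ι] in
/-- `toCube L w G y = G (L⁻¹ (y - w))`. [folklore] -/
@[simp]
theorem toCube_apply [Fintype ι] (L : V ≃L[ℝ] EuclideanSpace ℝ ι) (w : EuclideanSpace ℝ ι) (G : 𝓢(V, ℂ))
    (y : EuclideanSpace ℝ ι) : toCube L w G y = G (L.symm (y - w)) := rfl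

/-- The **box Fourier coefficients** of a test function `G` on `V` in the affine coordinates
`y = L v + w` (unit period box `L⁻¹([0,1]^ι - w)`): `c_n(G) = 𝓕(G ∘ (L⁻¹(· - w)))(n)`,
`n ∈ ℤ^ι`. [folklore] -/
def boxCoeff (L : V ≃L[ℝ] EuclideanSpace ℝ ι) (w : EuclideanSpace ℝ ι) (G : 𝓢(V, ℂ))
    (n : ι → ℤ) : ℂ :=
  𝓕 (toCube L w G : EuclideanSpace ℝ ι → ℂ) (intVec n)

/-- The box Fourier coefficients are absolutely summable against any polynomial weight
`(a |n|₁)^j`. [folklore] -/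
theorem summable_norm_boxCoeff_mul_pow (L : V ≃L[ℝ] EuclideanSpace ℝ ι) (w : EuclideanSpace ℝ ι)
    (G : 𝓢(V, ℂ)) (j : ℕ) {a : ℝ} (ha : 0 ≤ a) :
    Summable fun n : ι → ℤ => ‖boxCoeff L w G n‖ * (a * absSum n) ^ j :=
  summable_norm_fourier_intVec_mul_pow _ j ha

/-- **Pointwise Fourier expansion in a box.** If `G ∈ 𝓢(V)` vanishes off the box
`{v | ∀ c, (L v + w)_c ∈ [δ, 1 - δ]}`, `δ > 0`, then `∑_n c_n(G) e^{2πi n·(Lv + w)} = G(v)`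
for every `v` in the closed period box `{∀ c, (L v + w)_c ∈ [0, 1]}`. [folklore] -/
theorem hasSum_boxCoeff_mul_eChar (L : V ≃L[ℝ] EuclideanSpace ℝ ι) (w : EuclideanSpace ℝ ι)
    (G : 𝓢(V, ℂ)) {δ : ℝ} (hδ : 0 < δ)
    (hG : ∀ v, G v ≠ 0 → ∀ c, (L v + w) c ∈ Icc δ (1 - δ))
    (v : V) (hv : ∀ c, (L v + w) c ∈ Icc (0 : ℝ) 1) :
    HasSum (fun n : ι → ℤ => boxCoeff L w G n * eChar n (L v + w)) (G v) := by
  have h0 : ∀ y : EuclideanSpace ℝ ι, (∃ c, y c < δ ∨ 1 - δ < y c) → toCube L w G y = 0 := by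
    rintro y ⟨c, hc⟩
    rw [toCube_apply]
    by_contra hne
    have h := hG _ hne c
    simp only [ContinuousLinearEquiv.apply_symm_apply, sub_add_cancel, Set.mem_Icc] at h
    rcases hc with hc | hc <;> linarith [h.1, h.2]
  have h := hasSum_fourier_mul_eChar (toCube L w G) hδ h0 (L v + w) hv
  simpa [boxCoeff] using h

/-- Derivative bound for the characters in affine coordinates:
`‖Dᵏ[v ↦ e_n(Lv + w)]‖ ≤ (2π |n|₁ ‖L‖)^k`. [folklore] -/
theorem norm_iteratedFDeriv_eChar_affine_le (L : V →L[ℝ] EuclideanSpace ℝ ι) (w : EuclideanSpace ℝ ι)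
    (n : ι → ℤ) (k : ℕ) (v : V) :
    ‖iteratedFDeriv ℝ k (fun v => eChar n (L v + w)) v‖ ≤ (2 * π * absSum n * ‖L‖) ^ k := by
  have hcomp : (fun v => eChar n (L v + w)) = (fun y => eChar n (y + w)) ∘ L := rfl
  have hsm : ContDiff ℝ (⊤ : ℕ∞) (fun y : EuclideanSpace ℝ ι => eChar n (y + w)) :=
    (contDiff_eChar n).comp (contDiff_id.add contDiff_const)
  rw [hcomp, L.iteratedFDeriv_comp_right hsm v (i := k) (mod_cast le_top)]
  refine (ContinuousMultilinearMap.norm_compContinuousLinearMap_le _ _).trans ?_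
  rw [Finset.prod_const, Finset.card_univ, Fintype.card_fin, iteratedFDeriv_comp_add_right,
    mul_pow]
  gcongr
  exact norm_iteratedFDeriv_eChar_le n k _

/-- The characters in affine coordinates are smooth. [folklore] -/
theorem contDiff_eChar_affine (L : V →L[ℝ] EuclideanSpace ℝ ι) (w : EuclideanSpace ℝ ι) (n : ι → ℤ)
    {m : WithTop ℕ∞} : ContDiff ℝ m (fun v => eChar n (L v + w)) :=
  (contDiff_eChar n).comp (L.contDiff.add contDiff_const)

/-- **Fourier expansion of a compactly supported test function in the Schwartz topology.**
Let `y = L v + w` be affine coordinates on `V` (`L : V ≃L ℝ^ι`), let `G ∈ 𝓢(V, ℂ)` be supported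
in the box `{∀ c, y_c ∈ [δ, 1 - δ]}` (`δ > 0`) and let `P ∈ 𝓢(V, ℂ)` be a cutoff with `P = 1` on
`supp G` and `supp P ⊆ {∀ c, y_c ∈ [0, 1]}`. Then for ANY test functions `Q_n` with
`Q_n(v) = P(v) e^{2πi n·(Lv + w)}` (witness form),

  `∑_{n ∈ s} c_n(G) Q_n ⟶ G` in `𝓢(V, ℂ)` as `s ↑ ℤ^ι` (finite subsets, `atTop`),

`c_n(G) = boxCoeff L w G n`. Proof: pointwise `P · ∑_n c_n e_n = G`; the remainder after `s` is
`P · T_s`, `T_s = ∑_{n ∉ s} c_n e_n(L· + w)` smooth with `‖Dʲ T_s‖_∞ ≤ ∑_{n ∉ s} |c_n| (2π|n|₁‖L‖)ʲ →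
0` (`iteratedFDeriv_tsum_apply`, Schwartz decay of the coefficients), and the weighted Leibniz
bound `pow_mul_norm_iteratedFDeriv_mul_le` controls every Schwartz seminorm of `P · T_s`. This is
the classical multiple-Fourier-series proof that finite sums of products of one-variable test
functions are dense (as used for the Schwartz kernel theorem and for
`𝒮(ℝ^{m+n}) = 𝒮(ℝ^m) ⊗̂ 𝒮(ℝ^n)`, cf. OS 1973 §2). [folklore] -/
theorem tendsto_sum_boxCoeff_smul (L : V ≃L[ℝ] EuclideanSpace ℝ ι) (w : EuclideanSpace ℝ ι)
    {δ : ℝ} (hδ : 0 < δ) (G P : 𝓢(V, ℂ))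
    (hG : ∀ v ∈ tsupport (G : V → ℂ), ∀ c, (L v + w) c ∈ Icc δ (1 - δ))
    (hP1 : ∀ v ∈ tsupport (G : V → ℂ), P v = 1)
    (hP0 : ∀ v ∈ tsupport (P : V → ℂ), ∀ c, (L v + w) c ∈ Icc (0 : ℝ) 1)
    (Q : (ι → ℤ) → 𝓢(V, ℂ)) (hQ : ∀ n v, Q n v = P v * eChar n (L v + w)) :
    Tendsto (fun s : Finset (ι → ℤ) => ∑ n ∈ s, boxCoeff L w G n • Q n) atTop (𝓝 G) := by
  -- notation and basic estimates
  set c : (ι → ℤ) → ℂ := boxCoeff L w G with hc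
  let e : (ι → ℤ) → V → ℂ := fun n v => eChar n (L v + w)
  have he_smooth : ∀ n, ContDiff ℝ (⊤ : ℕ∞) (fun v => c n * e n v) := fun n =>
    contDiff_const.mul (contDiff_eChar_affine (L : V →L[ℝ] EuclideanSpace ℝ ι) w n)
  let b : ℕ → (ι → ℤ) → ℝ := fun k n => ‖c n‖ * (2 * π * ‖(L : V →L[ℝ] EuclideanSpace ℝ ι)‖ * absSum n) ^ k
  have hb_sum : ∀ k, Summable (b k) := fun k =>
    summable_norm_boxCoeff_mul_pow L w G k (by positivity)
  have hb_nonneg : ∀ k n, 0 ≤ b k n := fun k n =>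
    mul_nonneg (norm_nonneg _) (pow_nonneg (mul_nonneg (by positivity) (absSum_nonneg n)) _)
  have hb_bound : ∀ (k : ℕ) (n : ι → ℤ) (v : V),
      ‖iteratedFDeriv ℝ k (fun v => c n * e n v) v‖ ≤ b k n := by
    intro k n v
    change ‖iteratedFDeriv ℝ k (fun v => c n • eChar n ((L : V →L[ℝ] EuclideanSpace ℝ ι) v + w)) v‖ ≤ _
    rw [iteratedFDeriv_const_smul_apply'
      ((contDiff_eChar_affine (L : V →L[ℝ] EuclideanSpace ℝ ι) w n).contDiffAt), norm_smul]
    refine mul_le_mul_of_nonneg_left ?_ (norm_nonneg _)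
    refine (norm_iteratedFDeriv_eChar_affine_le (L : V →L[ℝ] EuclideanSpace ℝ ι) w n k v).trans ?_
    ring_nf
    rfl
  -- pointwise expansion: `P · ∑ c_n e_n = G`
  have hGzero : ∀ v, (¬ ∀ c', (L v + w) c' ∈ Icc (0 : ℝ) 1) → G v = 0 := by
    intro v hv
    by_contra hne
    exact hv fun c' => by
      have h := hG v (subset_tsupport _ hne) c'
      exact ⟨hδ.le.trans h.1, h.2.trans (by linarith)⟩
  have hpt : ∀ v, P v * (∑' n, c n * e n v) = G v := by
    intro v
    by_cases hv : ∀ c', (L v + w) c' ∈ Icc (0 : ℝ) 1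
    · rw [(hasSum_boxCoeff_mul_eChar L w G hδ (fun v hv => hG v (subset_tsupport _ hv)) v hv).tsum_eq]
      by_cases hGv : v ∈ tsupport (G : V → ℂ)
      · rw [hP1 v hGv, one_mul]
      · rw [image_eq_zero_of_notMem_tsupport hGv, mul_zero]
    · have hPv : P v = 0 := by
        by_contra hne
        exact hv (hP0 v (subset_tsupport _ hne))
      rw [hPv, zero_mul, hGzero v hv]
  -- tails
  have hsv : ∀ v, Summable fun n => c n * e n v := fun v =>
    Summable.of_norm_bounded (hb_sum 0) fun n => by simp [b, e, norm_eChar]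
  have htail_smooth : ∀ s : Finset (ι → ℤ),
      ContDiff ℝ (⊤ : ℕ∞) (fun v => ∑' n : {n // n ∉ s}, c n * e n v) := fun s =>
    contDiff_tsum (fun n => he_smooth n) (fun k _ => (hb_sum k).subtype _)
      (fun k n v _ => hb_bound k n v)
  have htail_bound : ∀ (s : Finset (ι → ℤ)) (k : ℕ) (v : V),
      ‖iteratedFDeriv ℝ k (fun v => ∑' n : {n // n ∉ s}, c n * e n v) v‖ ≤
        ∑' n : {n // n ∉ s}, b k n := by
    intro s k v
    rw [iteratedFDeriv_tsum_apply (N := (⊤ : ℕ∞)) (f := fun (n : {n // n ∉ s}) v => c n * e n v)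
      (v := fun k (n : {n // n ∉ s}) => b k n) (fun n => he_smooth n)
      (fun k _ => (hb_sum k).subtype _) (fun k n v _ => hb_bound k n v) (mod_cast le_top)]
    exact tsum_of_norm_bounded ((hb_sum k).subtype _).hasSum fun n => hb_bound k n v
  -- the remainder is `P · T_s`
  have hdiff : ∀ s : Finset (ι → ℤ),
      ⇑(G - ∑ n ∈ s, c n • Q n) = fun v => P v * ∑' n : {n // n ∉ s}, c n * e n v := by
    intro s
    funext v
    have hsplit := (hsv v).sum_add_tsum_compl (s := s)
    have hsum_apply : (∑ n ∈ s, c n • Q n) v = ∑ n ∈ s, c n * (P v * e n v) := by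
      rw [show (∑ n ∈ s, c n • Q n) v = ∑ n ∈ s, (c n • Q n) v from by simp]
      exact Finset.sum_congr rfl fun n _ => by rw [smul_apply, smul_eq_mul, hQ]
    rw [sub_apply, hsum_apply, ← hpt v, ← hsplit]
    have : ∑ n ∈ s, c n * (P v * e n v) = P v * ∑ n ∈ s, c n * e n v := by
      rw [Finset.mul_sum]; exact Finset.sum_congr rfl fun n _ => by ring
    rw [this, mul_add, add_sub_cancel_left]
    rfl
  -- seminorm estimate of the remainder
  have hest : ∀ (s : Finset (ι → ℤ)) (k l : ℕ),
      SchwartzMap.seminorm ℂ k l (G - ∑ n ∈ s, c n • Q n) ≤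
        ∑ j ∈ Finset.range (l + 1), (l.choose j : ℝ) * SchwartzMap.seminorm ℂ k j P *
          ∑' n : {n // n ∉ s}, b (l - j) n := by
    intro s k l
    refine SchwartzMap.seminorm_le_bound ℂ k l _ (Finset.sum_nonneg fun j _ =>
      mul_nonneg (mul_nonneg (Nat.cast_nonneg _) (apply_nonneg _ _))
        (tsum_nonneg fun n => hb_nonneg _ _)) fun v => ?_
    rw [hdiff s]
    exact pow_mul_norm_iteratedFDeriv_mul_le P (htail_smooth s) (fun j _ v => htail_bound s j v) k v
  -- the tails tend to zero
  have htend : ∀ j, Tendsto (fun s : Finset (ι → ℤ) => ∑' n : {n // n ∉ s}, b j n) atTop (𝓝 0) :=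
    fun j => tendsto_tsum_compl_atTop_zero (b j)
  rw [(schwartz_withSeminorms ℂ V ℂ).tendsto_nhds]
  rintro ⟨k, l⟩ ε hε
  have hR : Tendsto (fun s : Finset (ι → ℤ) => ∑ j ∈ Finset.range (l + 1),
      (l.choose j : ℝ) * SchwartzMap.seminorm ℂ k j P * ∑' n : {n // n ∉ s}, b (l - j) n)
      atTop (𝓝 0) := by
    have h := tendsto_finsetSum (Finset.range (l + 1)) fun j _ =>
      (htend (l - j)).const_mul ((l.choose j : ℝ) * SchwartzMap.seminorm ℂ k j P)
    simpa using h
  filter_upwards [hR.eventually (gt_mem_nhds hε)] with s hs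
  rw [SchwartzMap.schwartzSeminormFamily_apply, map_sub_rev]
  exact (hest s k l).trans_lt hs

end Schwartz

end Literature.MathematicalPhysics.QuantumLattice
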